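import Summits.KontsevichZagierPeriods.KontsevichZagierPeriods.Theorems.HodgeLevelDimOneRationalValues

/-!
# `OnePeriodNeedsTwoVariablesOfLogSpan` (item stmt-KontsevichZagierPeriods-10653, route HodgeLevel)

The level gap one dimension down, value form, relative to one displayed transcendence instance:
if the least positive real period `Ω₀ = L.minRealPeriod` of a real lattice `L` is not of the form
`β₀ + Σ βᵢ yᵢ` with `β₀, βᵢ` algebraic and `exp yᵢ` algebraic, then for real algebraic `β ≠ 0`, `γ`
no one-dimensional KZ-rational representation has value `γ + β·Ω₀`.

Proof (as planned in the route file): `DimOneRationalValues` (item 4992, proved in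
`Theorems/HodgeLevelDimOneRationalValues.lean` from the dimension-`≤ 1` completeness theorem of the
crux chain `NormalFormPrinciple`, line `SketchIdeator1`) writes `r.value = β₀ + Σ βᵢ yᵢ`; from
`r.value = γ + β Ω₀` solve `Ω₀ = (β₀ − γ)/β + Σ (βᵢ/β) yᵢ` and contradict the hypothesis.
Sources: M. Kontsevich, D. Zagier, *Periods* (2001) §1.2; A. Huber, G. Wüstholz,
*Transcendence and linear relations of 1-periods* (2022), Thm 15.3.
-/

noncomputable section

open Literature.NumberTheory.Transcendental Literature.NumberTheory.Transcendental.KZ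

namespace Summit.KontsevichZagierPeriods.HodgeLevel.OnePeriodNeedsTwoVariablesOfLogSpan

open Summit.KontsevichZagierPeriods.KontsevichZagierPeriods.Theses.HodgeLevel

/-- **Item stmt-KontsevichZagierPeriods-10653** (`OnePeriodNeedsTwoVariablesOfLogSpan`): for a real
lattice whose least positive real period `Ω₀` lies outside the Baker span
`ℚ̄ + Σ ℚ̄·yᵢ` (`exp yᵢ ∈ ℚ̄`), and real algebraic `β ≠ 0`, `γ`, no one-dimensional KZ-rational
representation has value `γ + β·Ω₀`. Unconditional consequence of `DimOneRationalValues`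
(item 4992). [cite: KontsevichZagier2001, §1.2] -/
theorem onePeriodNeedsTwoVariablesOfLogSpan_proof : OnePeriodNeedsTwoVariablesOfLogSpan := by
  unfold OnePeriodNeedsTwoVariablesOfLogSpan
  intro L _hL hspan β γ hβ hβ0 hγ r hr hval
  obtain ⟨k, β₀, b, y, hβ₀, hb, hy, hv⟩ := DimOneRationalValues.dimOneRationalValues_proof r hr
  have hβC : IsAlgebraic ℚ (β : ℂ) := by simpa using hβ.algebraMap (A := ℂ)
  have hγC : IsAlgebraic ℚ (γ : ℂ) := by simpa using hγ.algebraMap (A := ℂ)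
  have hβne : (β : ℂ) ≠ 0 := by exact_mod_cast hβ0
  refine hspan k ((β₀ - (γ : ℂ)) * (β : ℂ)⁻¹) (fun i => b i * (β : ℂ)⁻¹) y
    ((hβ₀.sub hγC).mul hβC.inv) (fun i => (hb i).mul hβC.inv) hy ?_
  have hvC : ((γ : ℂ) + (β : ℂ) * (L.minRealPeriod : ℂ)) = β₀ + ∑ i, b i * y i := by
    rw [← hv, hval]; push_cast; ring
  have key : (L.minRealPeriod : ℂ) = ((β₀ + ∑ i, b i * y i) - (γ : ℂ)) * (β : ℂ)⁻¹ := by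
    rw [← hvC]; field_simp; ring
  rw [key, sub_mul, add_mul, Finset.sum_mul]
  have hs : ∑ i, b i * y i * (β : ℂ)⁻¹ = ∑ i, b i * (β : ℂ)⁻¹ * y i :=
    Finset.sum_congr rfl fun i _ => by ring
  rw [hs]; ring

end Summit.KontsevichZagierPeriods.HodgeLevel.OnePeriodNeedsTwoVariablesOfLogSpan
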